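import Mathlib
import HarnessLib
import Literature.MathematicalPhysics.QuantumLattice.GaugeGroups
import Literature.Analysis.Matrix.DetExp
import Summits.Ventures.LatticeQCDFlow.Exactness.HaarStein
import Summits.Ventures.LatticeQCDFlow.Exactness.CompactHaar

/-!
# The one-link Schwinger–Dyson identity on SU(n): the Haar–Stein identity along `t ↦ exp(tA)`

HONEST FRAMING: exact (Metropolis-corrected) sampling algorithms for lattice gauge theory;
figures of merit are autocorrelation/cost numbers at stated couplings and volumes; no
continuum-physics claim.

Venture `LatticeQCDFlow` (cell pub-lqcd), topic `Exactness`, FANOUT row 9 (eng-latcore; the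
engine's `schwinger_dyson.residual_links`, acceptance test A11).  NEW WORK of the cell over
Mathlib and the tree's `Literature.Analysis.Matrix.DetExp` (`det (exp X) = exp (tr X)`,
Liouville's formula, and the entrywise derivative `hasDerivAt_exp_smul_apply` of `t ↦ exp(tX)`);
nothing is cited as a fact.  No local norm instance on matrices is used: the derivative of the
trace observables along the curve is assembled entry by entry.

`HaarStein.lean` (`gibbs_stein`) proves the population identity `⟨X h⟩ = ⟨h · X S⟩` for an
ABSTRACT curve of left translations; `HaarSteinUnitary.lean` (gen-7) instantiates it on `U(n)`.
The engine samples `SU(n)`: this file supplies the curve `t ↦ exp(tA)` INSIDE `SU(n)` for `A`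
skew-Hermitian AND TRACELESS — the determinant condition is exactly Liouville's formula
`det exp(tA) = exp(t tr A) = 1` — and states the one-link Schwinger–Dyson identity of the
`SU(n)` Wilson link law with no hypothesis left.  The sum over a generator family (the engine's
closed-form residual `R_l`) is `SchwingerDysonResidual.lean`, using `SUNGeneratorSum.lean`.

## Content (`n` finite; `A B R M : Matrix n n ℂ`; `μ = haarProbability SU(n)`)

* `exp_smul_mem_specialUnitaryGroup` — `Aᴴ = −A`, `tr A = 0 ⇒ exp(tA) ∈ SU(n)` for real `t`;
  `expCurveSU A hA hA0 : ℝ → SU(n)`, `coe_expCurveSU`, `expCurveSU_zero`.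
* `hasDerivAt_trace_exp_smul_mul` — `d/dt tr (exp(tA) M) = tr (A exp(tA) M)` (entrywise, from
  `DetExp`); `hasDerivAt_re_trace_exp_smul_mul` — its real part.
* `abs_re_trace_mul_le_of_mem_unitaryGroup` — `|Re tr (V M)| ≤ Σ ‖M i j‖` for unitary `V`.
* **`specialUnitary_schwingerDyson`** — for every real `c`, all `R B` and every skew-Hermitian
  traceless `A`:
  `∫ [Re tr (A U B) + c · Re tr (U B) · Re tr (A U R)] e^{c Re tr (U R)} dμ(U) = 0`,
  `μ` the Haar probability of `SU(n)` — the one-link Schwinger–Dyson identity of the link law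
  `∝ e^{c Re tr (U R)} dU` (`c = β/N`; `R` such that `U R` closes the plaquettes through the link,
  the engine's `A_l = U_l R_l`; equivalently `e^{−wilsonLink c Rᴴ}` of `WilsonOverrelaxation.lean`),
  source `B`, generator `A`.

Not here: the generator sum (`SchwingerDysonResidual.lean`), the lattice product measure (one link
with the rest frozen is `FibreLift.lean`'s reduction), statistical power (measured, A11).
-/

namespace Summit.Ventures.LatticeQCDFlow.Exactness

open Matrix NormedSpace MeasureTheory Metric
open scoped Topology

variable {n : Type*} [Fintype n] [DecidableEq n]

/-! ## §1 The curve `t ↦ exp(tA)` in `SU(n)` -/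

/-- `exp(tA) ∈ SU(n)` for skew-Hermitian traceless `A` and real `t`: unitarity from
`(exp tA)ᴴ = exp(−tA)`, determinant one from Liouville's formula `det exp = exp tr`. -/
theorem exp_smul_mem_specialUnitaryGroup {A : Matrix n n ℂ} (hA : Aᴴ = -A) (hA0 : A.trace = 0)
    (t : ℝ) : exp (t • A) ∈ Matrix.specialUnitaryGroup n ℂ := by
  rw [Matrix.mem_specialUnitaryGroup_iff]
  refine ⟨?_, ?_⟩
  · rw [Matrix.mem_unitaryGroup_iff, Matrix.star_eq_conjTranspose, ← Matrix.exp_conjTranspose,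
      Matrix.conjTranspose_smul, star_trivial, hA, smul_neg,
      ← Matrix.exp_add_of_commute (t • A) (-(t • A)) ((Commute.refl (t • A)).neg_right),
      add_neg_cancel, exp_zero]
  · rw [Literature.Analysis.Matrix.det_exp_eq_exp_trace, Matrix.trace_smul, hA0, smul_zero, exp_zero]

/-- The one-parameter curve `t ↦ exp(tA)` in `SU(n)` (`A` skew-Hermitian traceless). -/
noncomputable def expCurveSU (A : Matrix n n ℂ) (hA : Aᴴ = -A) (hA0 : A.trace = 0) (t : ℝ) :
    Matrix.specialUnitaryGroup n ℂ :=
  ⟨exp (t • A), exp_smul_mem_specialUnitaryGroup hA hA0 t⟩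

/-- Underlying matrix of the curve. -/
@[simp] theorem coe_expCurveSU {A : Matrix n n ℂ} (hA : Aᴴ = -A) (hA0 : A.trace = 0) (t : ℝ) :
    (↑(expCurveSU A hA hA0 t) : Matrix n n ℂ) = exp (t • A) := rfl

/-- The curve starts at the identity. -/
theorem expCurveSU_zero {A : Matrix n n ℂ} (hA : Aᴴ = -A) (hA0 : A.trace = 0) :
    expCurveSU A hA hA0 0 = 1 :=
  Subtype.ext (by simp [exp_zero])

/-! ## §2 Derivatives of the trace observables along the curve (entrywise, no matrix norm) -/

omit [DecidableEq n] in
/-- `tr (P M) = Σ_i Σ_k P i k · M k i`. -/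
theorem trace_mul_eq_sum_sum (P M : Matrix n n ℂ) :
    (P * M).trace = ∑ i, ∑ k, P i k * M k i := by
  simp only [Matrix.trace, Matrix.diag, Matrix.mul_apply]

/-- **`d/dt tr (exp(tA) M) = tr (A exp(tA) M)`** (from the entrywise derivative of `exp(tA)`). -/
theorem hasDerivAt_trace_exp_smul_mul (A M : Matrix n n ℂ) (t : ℝ) :
    HasDerivAt (fun x : ℝ => (exp (x • A) * M).trace) ((A * exp (t • A) * M).trace) t := by
  have hcomm : exp (t • A) * A = A * exp (t • A) :=
    (((Commute.refl A).smul_right t).exp_right).eq.symm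
  rw [← hcomm, trace_mul_eq_sum_sum]
  have hfun : (fun x : ℝ => (exp (x • A) * M).trace) = fun x => ∑ i, ∑ k, exp (x • A) i k * M k i :=
    funext fun x => trace_mul_eq_sum_sum _ _
  rw [hfun]
  exact HasDerivAt.fun_sum fun i _ => HasDerivAt.fun_sum fun k _ =>
    (Literature.Analysis.Matrix.hasDerivAt_exp_smul_apply A i k t).mul_const (M k i)

/-- Real part: `d/dt Re tr (exp(tA) M) = Re tr (A exp(tA) M)`. -/
theorem hasDerivAt_re_trace_exp_smul_mul (A M : Matrix n n ℂ) (t : ℝ) :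
    HasDerivAt (fun x : ℝ => ((exp (x • A) * M).trace).re) (((A * exp (t • A) * M).trace).re) t := by
  have h := Complex.reCLM.hasFDerivAt.comp_hasDerivAt t (hasDerivAt_trace_exp_smul_mul A M t)
  simpa [Function.comp_def] using h

/-! ## §3 Bounds: entries of a unitary are at most one -/

omit [DecidableEq n] in
/-- `|Re tr (V M)| ≤ Σᵢⱼ ‖M i j‖` for `V ∈ U(n)`. -/
theorem abs_re_trace_mul_le_of_mem_unitaryGroup [DecidableEq n] {V : Matrix n n ℂ}
    (hV : V ∈ Matrix.unitaryGroup n ℂ) (M : Matrix n n ℂ) :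
    |((V * M).trace).re| ≤ ∑ i, ∑ j, ‖M i j‖ := by
  refine (Complex.abs_re_le_norm _).trans ?_
  rw [Matrix.trace]
  refine (norm_sum_le _ _).trans ?_
  rw [Finset.sum_comm]
  refine Finset.sum_le_sum fun i _ => ?_
  rw [Matrix.diag_apply, Matrix.mul_apply]
  refine (norm_sum_le _ _).trans (Finset.sum_le_sum fun j _ => ?_)
  rw [norm_mul]
  calc ‖V i j‖ * ‖M j i‖ ≤ 1 * ‖M j i‖ :=
        mul_le_mul_of_nonneg_right (entry_norm_bound_of_unitary hV i j) (norm_nonneg _)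
    _ = ‖M j i‖ := one_mul _

/-! ## §4 The one-link Schwinger–Dyson identity on `SU(n)` -/

/-- **One-link Schwinger–Dyson identity on `SU(n)`.**  For the Haar probability `μ` of `SU(n)`,
every real `c`, every `R B : Matrix n n ℂ` and every skew-Hermitian traceless generator `A`:
`∫ [Re tr (A U B) + c · Re tr (U B) · Re tr (A U R)] · e^{c Re tr (U R)} dμ(U) = 0`. -/
theorem specialUnitary_schwingerDyson (c : ℝ) (R B A : Matrix n n ℂ) (hA : Aᴴ = -A)
    (hA0 : A.trace = 0) :
    ∫ U, ((((A * (U : Matrix n n ℂ) * B).trace).re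
        + c * (((U : Matrix n n ℂ) * B).trace).re * ((A * (U : Matrix n n ℂ) * R).trace).re)
        * Real.exp (c * (((U : Matrix n n ℂ) * R).trace).re))
      ∂(Literature.MathematicalPhysics.QuantumFieldTheory.haarProbability
          (Matrix.specialUnitaryGroup n ℂ)) = 0 := by
  set μ := Literature.MathematicalPhysics.QuantumFieldTheory.haarProbability
    (Matrix.specialUnitaryGroup n ℂ)
  -- uniform bounds: β M = Σ ‖M i j‖
  set βB := ∑ i, ∑ j, ‖B i j‖
  set βBA := ∑ i, ∑ j, ‖(B * A) i j‖
  set βR := ∑ i, ∑ j, ‖R i j‖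
  set βRA := ∑ i, ∑ j, ‖(R * A) i j‖
  set Sβ := βB + βBA + βR + βRA with hS
  set C := (1 + |c|) * Sβ with hCdef
  have hβB : 0 ≤ βB := by positivity
  have hβBA : 0 ≤ βBA := by positivity
  have hβR : 0 ≤ βR := by positivity
  have hβRA : 0 ≤ βRA := by positivity
  have hS0 : 0 ≤ Sβ := by rw [hS]; positivity
  have hc1 : 1 ≤ 1 + |c| := by linarith [abs_nonneg c]
  have hcc : |c| ≤ 1 + |c| := by linarith
  have hc0 : 0 ≤ 1 + |c| := by linarith [abs_nonneg c]
  have le_C : ∀ x : ℝ, 0 ≤ x → x ≤ Sβ → x ≤ C := fun x hx hxS => by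
    rw [hCdef]; calc x = 1 * x := (one_mul x).symm
      _ ≤ (1 + |c|) * Sβ := mul_le_mul hc1 hxS hx hc0
  have le_C' : ∀ x : ℝ, 0 ≤ x → x ≤ Sβ → |c| * x ≤ C := fun x hx hxS => by
    rw [hCdef]; exact mul_le_mul hcc hxS hx hc0
  -- every group element is a unitary matrix
  have hU : ∀ V : Matrix.specialUnitaryGroup n ℂ, (V : Matrix n n ℂ) ∈ Matrix.unitaryGroup n ℂ :=
    fun V => Matrix.specialUnitaryGroup_le_unitaryGroup V.2
  -- cyclicity: Re tr (A V M) = Re tr (V (M A))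
  have cyc : ∀ (V M : Matrix n n ℂ), ((A * V * M).trace).re = ((V * (M * A)).trace).re :=
    fun V M => by rw [Matrix.mul_assoc, Matrix.trace_mul_comm, Matrix.mul_assoc]
  -- the curve acts by left multiplication: ↑(γ t * U) = exp(tA) * ↑U
  have hγU : ∀ (t : ℝ) (U : Matrix.specialUnitaryGroup n ℂ),
      (↑(expCurveSU A hA hA0 t * U) : Matrix n n ℂ) = exp (t • A) * (U : Matrix n n ℂ) :=
    fun t U => by rw [Submonoid.coe_mul, coe_expCurveSU]
  have key := gibbs_stein (μ := μ) (γ := expCurveSU A hA hA0) (ε := 1) (C := C)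
    (h := fun U => (((U : Matrix n n ℂ) * B).trace).re)
    (S := fun U => -(c * (((U : Matrix n n ℂ) * R).trace).re))
    (Dh := fun t U => ((A * exp (t • A) * ((U : Matrix n n ℂ) * B)).trace).re)
    (DS := fun t U => -(c * ((A * exp (t • A) * ((U : Matrix n n ℂ) * R)).trace).re))
    one_pos (expCurveSU_zero hA hA0)
    (Complex.continuous_re.comp
      ((continuous_subtype_val.matrix_mul continuous_const).matrix_trace)).measurable
    ((Complex.continuous_re.comp
      ((continuous_subtype_val.matrix_mul continuous_const).matrix_trace)).measurable.const_mul c).neg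
    (Complex.continuous_re.comp ((continuous_const.matrix_mul
      (continuous_subtype_val.matrix_mul continuous_const)).matrix_trace)).measurable
    ((Complex.continuous_re.comp ((continuous_const.matrix_mul
      (continuous_subtype_val.matrix_mul continuous_const)).matrix_trace)).measurable.const_mul c).neg
    ?_ ?_ ?_ ?_ ?_ ?_
  · -- conclusion: exp (0 • A) = 1, unfold
    have h0 : exp ((0 : ℝ) • A) = 1 := by rw [zero_smul, exp_zero]
    simp only [h0, Matrix.mul_one, neg_neg, mul_neg, sub_neg_eq_add] at key
    refine (integral_congr_ae (Filter.Eventually.of_forall fun U => ?_)).trans key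
    simp only [Matrix.mul_assoc]
    ring
  · -- derivative of h along the curve
    intro U t _
    have hf : ∀ x : ℝ, (fun U : Matrix.specialUnitaryGroup n ℂ => (((U : Matrix n n ℂ) * B).trace).re)
        (expCurveSU A hA hA0 x * U) = ((exp (x • A) * ((U : Matrix n n ℂ) * B)).trace).re := by
      intro x; simp only [hγU, Matrix.mul_assoc]
    refine (hasDerivAt_re_trace_exp_smul_mul A ((U : Matrix n n ℂ) * B) t).congr_of_eventuallyEq
      (Filter.Eventually.of_forall hf)
  · -- derivative of S along the curve
    intro U t _
    have hf : ∀ x : ℝ, (fun U : Matrix.specialUnitaryGroup n ℂ =>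
        -(c * (((U : Matrix n n ℂ) * R).trace).re)) (expCurveSU A hA hA0 x * U)
        = -(c * ((exp (x • A) * ((U : Matrix n n ℂ) * R)).trace).re) := by
      intro x; simp only [hγU, Matrix.mul_assoc]
    exact (((hasDerivAt_re_trace_exp_smul_mul A ((U : Matrix n n ℂ) * R) t).const_mul c).neg
      ).congr_of_eventuallyEq (Filter.Eventually.of_forall hf)
  · -- |h U| ≤ C
    intro U
    exact (abs_re_trace_mul_le_of_mem_unitaryGroup (hU U) B).trans
      (le_C βB hβB (by rw [hS]; linarith))
  · -- |S U| ≤ C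
    intro U
    rw [abs_neg, abs_mul]
    exact (mul_le_mul_of_nonneg_left (abs_re_trace_mul_le_of_mem_unitaryGroup (hU U) R)
      (abs_nonneg c)).trans (le_C' βR hβR (by rw [hS]; linarith))
  · -- |Dh t U| ≤ C
    intro U t _
    rw [cyc, Matrix.mul_assoc (U : Matrix n n ℂ) B A,
      ← Matrix.mul_assoc (exp (t • A)) (U : Matrix n n ℂ) (B * A), ← hγU]
    exact (abs_re_trace_mul_le_of_mem_unitaryGroup (hU _) _).trans
      (le_C βBA hβBA (by rw [hS]; linarith))
  · -- |DS t U| ≤ C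
    intro U t _
    rw [abs_neg, abs_mul, cyc, Matrix.mul_assoc (U : Matrix n n ℂ) R A,
      ← Matrix.mul_assoc (exp (t • A)) (U : Matrix n n ℂ) (R * A), ← hγU]
    exact (mul_le_mul_of_nonneg_left (abs_re_trace_mul_le_of_mem_unitaryGroup (hU _) _)
      (abs_nonneg c)).trans (le_C' βRA hβRA (by rw [hS]; linarith))

end Summit.Ventures.LatticeQCDFlow.Exactness
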